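import Summits.QuantumFields.BalabanUV.T4Continuum.Support.NE3SlicePoincareSkeleton
import Summits.QuantumFields.BalabanUV.T4Continuum.Support.NE3CornerGaugePoincare
import Summits.QuantumFields.BalabanUV.T4Continuum.Support.NE3CurvedProjectedLandau
import HarnessLib

/-!
# NE3SlicePoincareYBound (T⁴ programme, node NE3, row K6 of ruling ρ-g22-2, part K6c-1b-γ of the cut ρ-g23-3 §3) — (S6)+(S8): THE SLICE NORM
# AGAINST THE COMPETITOR, `y² ≤ h² + G̃ + 2√ρ²·√Ξ`, AND K6-Ξ ON `ξ := ζ̃ − ζ′`: `Ξ ≤ 4M²·(2G̃ + 2G_ζ)`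

NE3 (node U1b) formalisation swarm `b2b-balaban-t4-ne3-formalise-*`, leaf seat `b2b-balaban-t4-ne3-formalise-leaf-02` (gen 6), row **K6**
(booked → leaf-02 lineage; blueprint `HOME/t4/b2b-balaban-t4-ne3-p1/g23/D-ne3p1-g23-1.md` (S6)(S8)).  Two short consequences, BY NAME, of K6a
`NE3SlicePoincareSkeleton.sum_nhsNormSq_le_competitor_of_orth` (min-norm on `T_♮(W)` + the orthogonality (S2)(iii)), K6a's Cauchy–Schwarz
`abs_sum_hsR_le`, and the owner's K6-Ξ `NE3CornerGaugePoincare.sum_nhsNormSq_le_four_mul_of_bmeanIterW_eq_zero` (Poincaré on `Ξ₀₀(W)`).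
All [folklore], 0 sorry, 0 def; sums over `periodBox (L^{k+1}·N)` (`= tower L N (k+1)`, `NE3CurvedProjectedLandau.tower_eq_pow_mul`):
§1 **`y_sq_le`** — for `Y ∈ frameFreeBlockLandauW L N (k+1) W`, `Y = η′ + gaugeDir W ζ′` with `Σ hsR ζ′ (covDiv W η′) = 0`, and ANY periodic `ζ̃` with
   `ζ̃ − ζ′ ∈ cornerGaugeSpaceW L (k+1) W (tower L N (k+1)) (L^{k+1})`:
   `ΣΣ nhsNormSq Y ≤ ΣΣ nhsNormSq η′ + ΣΣ nhsNormSq (gaugeDir W ζ̃) + 2·(√(Σ nhsNormSq (covDiv W η′))·√(Σ nhsNormSq (ζ̃ − ζ′)))`;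
§2 **`xi_sq_le`** — in the tower class with K6-Ξ's displayed smallness: `Σ nhsNormSq (ζ̃ − ζ′) ≤ 4·(M²·(2·ΣΣ nhsNormSq (gaugeDir W ζ̃) + 2·ΣΣ nhsNormSq (gaugeDir W ζ′)))`.
HONEST FRAMING.  Bookkeeping on OUR lattice objects at ONE unitary background; nothing about Bałaban's minimisers; (P♮)_W, (ML_w) at `W ≠ 1`,
T-E_w and NE3 are NOT proved; spine PROVED 0∕9; finite T⁴ rung (B)+1 — NOT infinite volume, NOT mass gap, NOT BetaPertH, NOT Clay.  ABSOLUTE RULE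
kept: no printed sentence is a hypothesis.  PLACEMENT: `Summits/QuantumFields/BalabanUV/`; imports accepted modules only; moves nothing.
HONEST DEPENDENCY: continuum YM on T⁴ ⇐ BetaPertH ∧ nine spine estimates (0/9 proved); BetaPertH ⇐ (D1) ∧ (D4) ∧ CAP+tail; G-an2-4
gates asym, D1 and NE2/3/4.
-/

set_option autoImplicit false

open scoped BigOperators Matrix.Norms.L2Operator
open Finset

namespace Summit.QuantumFields.BalabanUV.T4Continuum.NE3SlicePoincareYBound

open Literature.MathematicalPhysics.QuantumFieldTheory.Balaban1983to89
open B7Prop1Explicit B7Prop2Explicit MatrixNorms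
open T4AveragingDeficitWall (IsUnitaryCfg IsSkewDir SmallField)
open T4AveragingDeficitWallBoundary (IsPeriodicCfg periodBox mem_periodBox)
open AveragingDeficitPeriodicCounting (IsPeriodicDir)
open AveragingDeficitTwoLevelPrep (prop1Radius)
open AveragingDeficitMultiLevelPrep (cavgIter tower LevelSmall)
open SpreadLift (loopRad)
open BlockAveragePushDirGauge (gaugeDir)
open NE3CovariantCalculus (hsR nhsNormSq_sub_le)
open NE3CovariantWeitzenbock (covDiv)
open NE3CovariantBlockMean (bmeanIterW)
open NE3FrameFreeSliceW (frameFreeBlockLandauW cornerGaugeSpaceW mem_cornerGaugeSpaceW_iff)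
open NE3CornerGaugePoincare (sum_nhsNormSq_le_four_mul_of_bmeanIterW_eq_zero)
open NE3SlicePoincareSkeleton (sum_nhsNormSq_le_competitor_of_orth abs_sum_hsR_le gaugeDir_sub_fun')

noncomputable section

variable {d : ℕ} {n : Type*} [Fintype n] [DecidableEq n]

/-! ## §1 The slice norm against a competitor -/

/-- **(S6)+(S8)+(S2)(iii): `y² ≤ h² + G̃ + 2·√ρ²·√Ξ`.**  For `Y ∈ frameFreeBlockLandauW L N (k+1) W` (unitary `W`), a split `Y = η′ + gaugeDir W ζ′` with
η′ periodic and the orthogonality `Σ hsR ζ′ (covDiv W η′) = 0`, and any periodic `ζ̃` with `ζ̃ − ζ′ ∈ Ξ₀₀(W)`: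
`ΣΣ nhsNormSq Y ≤ ΣΣ nhsNormSq η′ + ΣΣ nhsNormSq (gaugeDir W ζ̃) + 2·(√(Σ nhsNormSq (covDiv W η′))·√(Σ nhsNormSq (ζ̃ − ζ′)))`
(sums over `periodBox (L^{k+1}·N)`). [folklore] -/
theorem y_sq_le {L N : ℕ} (k : ℕ) (hP : 1 ≤ tower L N (k + 1)) {W : Site d → Fin d → (Matrix n n ℂ)ˣ} (hWu : IsUnitaryCfg W)
    {Y : Site d → Fin d → Matrix n n ℂ} (hY : Y ∈ frameFreeBlockLandauW (d := d) (n := n) L N (k + 1) W)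
    {η' : Site d → Fin d → Matrix n n ℂ} (hη'P : IsPeriodicDir η' ((tower L N (k + 1) : ℕ) : ℤ)) {ζ' ζt : Site d → Matrix n n ℂ}
    (hζtP : ∀ (x : Site d) (τ : Fin d), ζt (x + ((tower L N (k + 1) : ℕ) : ℤ) • e τ) = ζt x)
    (hYeq : ∀ (x : Site d) (κ : Fin d), Y x κ = η' x κ + gaugeDir W ζ' x κ)
    (hξ : (fun x => ζt x - ζ' x) ∈ cornerGaugeSpaceW (d := d) (n := n) L (k + 1) W (tower L N (k + 1)) (L ^ (k + 1)))
    (horth : ∑ x ∈ periodBox (d := d) (tower L N (k + 1)), hsR (ζ' x) (covDiv W η' x) = 0) :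
    ∑ x ∈ periodBox (d := d) (L ^ (k + 1) * N), ∑ κ : Fin d, nhsNormSq (Y x κ)
      ≤ ∑ x ∈ periodBox (d := d) (L ^ (k + 1) * N), ∑ κ : Fin d, nhsNormSq (η' x κ)
        + ∑ x ∈ periodBox (d := d) (L ^ (k + 1) * N), ∑ κ : Fin d, nhsNormSq (gaugeDir W ζt x κ)
        + 2 * (Real.sqrt (∑ x ∈ periodBox (d := d) (L ^ (k + 1) * N), nhsNormSq (covDiv W η' x))
            * Real.sqrt (∑ x ∈ periodBox (d := d) (L ^ (k + 1) * N), nhsNormSq (ζt x - ζ' x))) := by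
  have htow : tower L N (k + 1) = L ^ (k + 1) * N := NE3CurvedProjectedLandau.tower_eq_pow_mul L N (k + 1)
  have h := sum_nhsNormSq_le_competitor_of_orth hP hWu hY hη'P hζtP hYeq hξ horth
  have hcs := abs_sum_hsR_le (tower L N (k + 1)) (fun x => covDiv W η' x) (fun x => ζt x - ζ' x)
  rw [htow] at h hcs
  linarith [le_abs_self (∑ x ∈ periodBox (d := d) (L ^ (k + 1) * N), hsR (covDiv W η' x) (ζt x - ζ' x))]

/-! ## §2 K6-Ξ on `ξ := ζ̃ − ζ′` -/

/-- **`Ξ ≤ 4M²·(2G̃ + 2G_ζ)`**: for `ζ̃ − ζ′ ∈ Ξ₀₀(W)` in the tower class (`2 ≤ L`, unitary `W`, `0 ≤ x`, `LevelSmall d L k x`, `SmallField W x`) under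
K6-Ξ's displayed smallness, `Σ nhsNormSq (ζ̃ − ζ′) ≤ 4·(M²·(2·ΣΣ nhsNormSq (gaugeDir W ζ̃) + 2·ΣΣ nhsNormSq (gaugeDir W ζ′)))`, `M = L^{k+1}`
(K6-Ξ `sum_nhsNormSq_le_four_mul_of_bmeanIterW_eq_zero` + `gaugeDir (ζ̃ − ζ′) = gaugeDir ζ̃ − gaugeDir ζ′`). [folklore] -/
theorem xi_sq_le [Nonempty n] {L : ℕ} (hL : 2 ≤ L) (N k : ℕ) {W : Site d → Fin d → (Matrix n n ℂ)ˣ} {x : ℝ}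
    (hWu : IsUnitaryCfg W) (hx : 0 ≤ x) (hs : LevelSmall d L k x) (hWx : SmallField W x)
    (hsmall : 8 * d * (((L : ℝ) ^ (k + 1)) * (((d : ℝ) - 1) * (((L : ℝ) ^ (k + 1)) - 1) * x)) ^ 2
      + 2 * (Fintype.card n * (4 * (d : ℝ) ^ 2 * ((L : ℝ) ^ (k + 1) - 1) ^ 2 * x + 16 * d * loopRad d L ((prop1Radius d L)^[k] x)) ^ 2)
        ≤ 1 / 2)
    {ζ' ζt : Site d → Matrix n n ℂ}
    (hξ : (fun x => ζt x - ζ' x) ∈ cornerGaugeSpaceW (d := d) (n := n) L (k + 1) W (tower L N (k + 1)) (L ^ (k + 1))) :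
    ∑ x ∈ periodBox (d := d) (L ^ (k + 1) * N), nhsNormSq (ζt x - ζ' x)
      ≤ 4 * (((L : ℝ) ^ (k + 1)) ^ 2
          * (2 * ∑ x ∈ periodBox (d := d) (L ^ (k + 1) * N), ∑ μ : Fin d, nhsNormSq (gaugeDir W ζt x μ)
            + 2 * ∑ x ∈ periodBox (d := d) (L ^ (k + 1) * N), ∑ μ : Fin d, nhsNormSq (gaugeDir W ζ' x μ))) := by
  have hmean : bmeanIterW L (k + 1) W (fun x => ζt x - ζ' x) = 0 := (mem_cornerGaugeSpaceW_iff.1 hξ).2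
  have hξ0 : ∀ z ∈ periodBox (d := d) N, bmeanIterW L (k + 1) W (fun x => ζt x - ζ' x) z = 0 :=
    fun z _ => by rw [hmean]; rfl
  have hK := sum_nhsNormSq_le_four_mul_of_bmeanIterW_eq_zero hL k hWu hx hs hWx N (fun x => ζt x - ζ' x) hξ0 hsmall
  have hsplit : ∑ x ∈ periodBox (d := d) (L ^ (k + 1) * N), ∑ μ : Fin d, nhsNormSq (gaugeDir W (fun x => ζt x - ζ' x) x μ)
      ≤ 2 * ∑ x ∈ periodBox (d := d) (L ^ (k + 1) * N), ∑ μ : Fin d, nhsNormSq (gaugeDir W ζt x μ)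
        + 2 * ∑ x ∈ periodBox (d := d) (L ^ (k + 1) * N), ∑ μ : Fin d, nhsNormSq (gaugeDir W ζ' x μ) := by
    calc ∑ x ∈ periodBox (d := d) (L ^ (k + 1) * N), ∑ μ : Fin d, nhsNormSq (gaugeDir W (fun x => ζt x - ζ' x) x μ)
        ≤ ∑ x ∈ periodBox (d := d) (L ^ (k + 1) * N), ∑ μ : Fin d,
            (2 * (nhsNormSq (gaugeDir W ζt x μ) + nhsNormSq (gaugeDir W ζ' x μ))) := by
          refine sum_le_sum fun x _ => sum_le_sum fun μ _ => ?_
          rw [gaugeDir_sub_fun']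
          exact nhsNormSq_sub_le _ _
      _ = _ := by simp only [mul_add, sum_add_distrib, mul_sum]
  have hM : 0 ≤ ((L : ℝ) ^ (k + 1)) ^ 2 := by positivity
  nlinarith [hK, mul_le_mul_of_nonneg_left hsplit hM]

end

end Summit.QuantumFields.BalabanUV.T4Continuum.NE3SlicePoincareYBound
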